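import Mathlib
import Summits.ValiantsHypothesis.ValiantsHypothesis.Theorems.LacunarySymmetroidMatrixDescartesInertiaJumpPencil
import Summits.ValiantsHypothesis.ValiantsHypothesis.Theorems.LacunarySymmetroidMatrixDescartesInertiaIndexTelescope

/-!
# `MatrixDescartes` (stmt-ValiantsHypothesis-18050) — INERTIA KIT, IV-b: THE INDEX FORMULA — on a window whose roots are all of
# definite type, #roots of `det F` WITH MULTIPLICITY = (inertia drift) + 2 × (counter-drift); a window whose roots are all of
# ONE type carries EXACTLY `|Δν|` roots, for EVERY lacunary symmetric pencil format

HONEST FRAMING.  Cell `pub-symmetroid`, seat `val-sym-mdr-p2` (gen 17); helper file `--supports` the crux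
`Theses.LacunarySymmetroid.MatrixDescartes`, NO closure claim.  General theorems for EVERY real symmetric lacunary pencil
`F(X) = ∑ₖ X^{dₖ}Sₖ` (any index types `ι`, `κ`, any exponents, any symmetric letters): the INDEX TELESCOPE (`…InertiaIndexTelescope`)
fed with the DEFINITE-TYPE JUMP LAW (`…InertiaJumpPencil`).  Nothing here bears on the crux in its window, on `stub_twoSided`, on
`DoorA26`/`DoorA34`, registers, or `VP ≠ VNP`.

TERMS.  A root `t` of `det F` is of NEGATIVE TYPE if every non-zero kernel vector `u` of `F(t)` has `P_u′(t) < 0` for its Rayleigh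
polynomial `P_u = ∑ₖ (uᵀSₖu)X^{dₖ}` (equivalently `uᵀF′(t)u < 0`: the kernel form is negative definite — every eigenvalue branch
through `0` at `t` is DECREASING); POSITIVE TYPE mirrors; DEFINITE TYPE = one of the two [GohbergLancasterRodman2005, §12.4].
CONTENT.  `sum_corank_eq_card_roots_filter`: on any set of definite-type roots, `∑ dim ker F(t) = #roots with multiplicity` (tree
`Multiplicity.rootMultiplicity_det_pencil_eq_corank`).  THE ONE-TYPE WINDOW LAWS `card_roots_Ioo_add_negIndex_eq_of_negType` /
`…_of_posType`: `a < b` non-singular scales, every root in `(a, b)` of negative type ⇒ `#{roots in (a,b) with multiplicity} + ν(F(a))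
= ν(F(b))` and `… + π(F(b)) = π(F(a))` (positive type mirrors) — the EXACT window count of g16's sector theorem
(`DefiniteMoments.card_roots_window_eq`) with NO definiteness at the ends and NO Rayleigh budget: one-typedness of the roots alone.
THE INDEX FORMULA `index_formula`: every root in `(a, b)` of definite type, `N⁻` / `N⁺` the negative- / positive-type roots counted
with multiplicity ⇒ `ν(F(b)) + N⁺ = ν(F(a)) + N⁻`, `π(F(b)) + N⁻ = π(F(a)) + N⁺`, `N⁻ + N⁺ = #{roots in (a,b) with multiplicity}`;
hence `#roots = |ν(F(b)) − ν(F(a))| + 2·min(N⁻, N⁺) ≤ m + 2·min(N⁻, N⁺)`: every root beyond the inertia budget `m` is paid for by a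
root of the OPPOSITE type (a «revival»).  [folklore]; axioms standard; no definitions.
-/

-- layout Summits/ValiantsHypothesis/ValiantsHypothesis forces the duplicated namespace component
set_option linter.dupNamespace false

namespace Summit.ValiantsHypothesis.ValiantsHypothesis.Theorems.LacunarySymmetroidMatrixDescartes

open Matrix Finset Polynomial
open scoped BigOperators Topology

namespace Inertia

variable {ι : Type} [Fintype ι] [DecidableEq ι]

section Pencil

variable {κ : Type} [Fintype κ]

/-! ## §1 Multiplicity currency on definite-type roots -/

/-- **Definite type ⇒ `∑ dim ker = #roots with multiplicity`.**  If at every root `t` of `det F` selected by `p` every non-zero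
kernel vector has `P_u′(t) ≠ 0`, then `∑_{t ∈ roots, p t} dim ker F(t) = card (roots.filter p)`. [folklore] -/
theorem sum_corank_eq_card_roots_filter (d : κ → ℕ) (S : κ → Matrix ι ι ℝ) (hS : ∀ k, (S k).IsSymm)
    (p : ℝ → Prop) [DecidablePred p]
    (hdef : ∀ t ∈ (Matrix.det (∑ k, ((X : ℝ[X]) ^ d k) • (S k).map C)).roots.toFinset.filter p,
      ∀ u : ι → ℝ, (∑ k, t ^ d k • S k) *ᵥ u = 0 → u ≠ 0 →
        (derivative (∑ k, C (u ⬝ᵥ (S k *ᵥ u)) * (X : ℝ[X]) ^ d k)).eval t ≠ 0) :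
    ∑ t ∈ (Matrix.det (∑ k, ((X : ℝ[X]) ^ d k) • (S k).map C)).roots.toFinset.filter p,
        (Fintype.card ι - (∑ k, t ^ d k • S k).rank)
      = Multiset.card ((Matrix.det (∑ k, ((X : ℝ[X]) ^ d k) • (S k).map C)).roots.filter p) := by
  set P := Matrix.det (∑ k, ((X : ℝ[X]) ^ d k) • (S k).map C) with hP
  calc ∑ t ∈ P.roots.toFinset.filter p, (Fintype.card ι - (∑ k, t ^ d k • S k).rank)
      = ∑ t ∈ P.roots.toFinset.filter p, P.rootMultiplicity t :=
        Finset.sum_congr rfl fun t ht =>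
          ((Multiplicity.rootMultiplicity_det_pencil_eq_corank d S hS t (hdef t ht)).2).symm
    _ = ∑ t ∈ (P.roots.filter p).toFinset, (P.roots.filter p).count t := by
        rw [Multiset.toFinset_filter]
        refine Finset.sum_congr rfl fun t ht => ?_
        rw [Multiset.count_filter_of_pos (Finset.mem_filter.1 ht).2, count_roots]
    _ = Multiset.card (P.roots.filter p) := Multiset.toFinset_sum_count_eq _

/-- The determinant polynomial is non-zero as soon as one evaluated pencil is non-singular. [folklore] -/
theorem det_pencil_ne_zero_of_eval (d : κ → ℕ) (S : κ → Matrix ι ι ℝ) {a : ℝ} (ha : (∑ k, a ^ d k • S k).det ≠ 0) :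
    Matrix.det (∑ k, ((X : ℝ[X]) ^ d k) • (S k).map C) ≠ 0 := by
  intro h
  apply ha
  rw [← DefiniteMoments.eval_det_pencil, h, eval_zero]

/-! ## §2 The one-type window laws -/

/-- **THE ONE-TYPE WINDOW LAW (negative type).**  `F(X) = ∑ₖ X^{dₖ}Sₖ` real symmetric, `a < b` with `F(a)`, `F(b)` non-singular,
and every root of `det F` in `(a, b)` of NEGATIVE type.  Then the roots of `det F` in `(a, b)` COUNTED WITH MULTIPLICITY number
EXACTLY `ν(F(b)) − ν(F(a))`, and also exactly `π(F(a)) − π(F(b))`. [folklore] -/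
theorem card_roots_Ioo_add_negIndex_eq_of_negType (d : κ → ℕ) (S : κ → Matrix ι ι ℝ) (hS : ∀ k, (S k).IsSymm)
    {a b : ℝ} (hab : a < b) (ha : (∑ k, a ^ d k • S k).det ≠ 0) (hb : (∑ k, b ^ d k • S k).det ≠ 0)
    (hneg : ∀ t, a < t → t < b → (∑ k, t ^ d k • S k).det = 0 → ∀ u : ι → ℝ, (∑ k, t ^ d k • S k) *ᵥ u = 0 → u ≠ 0 →
      (derivative (∑ k, C (u ⬝ᵥ (S k *ᵥ u)) * (X : ℝ[X]) ^ d k)).eval t < 0) :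
    Multiset.card ((Matrix.det (∑ k, ((X : ℝ[X]) ^ d k) • (S k).map C)).roots.filter (fun t => a < t ∧ t < b))
        + Fintype.card {j // (isHermitian_pencil d S hS a).eigenvalues j < 0}
      = Fintype.card {j // (isHermitian_pencil d S hS b).eigenvalues j < 0} ∧
    Multiset.card ((Matrix.det (∑ k, ((X : ℝ[X]) ^ d k) • (S k).map C)).roots.filter (fun t => a < t ∧ t < b))
        + Fintype.card {j // 0 < (isHermitian_pencil d S hS b).eigenvalues j}
      = Fintype.card {j // 0 < (isHermitian_pencil d S hS a).eigenvalues j} := by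
  classical
  set P := Matrix.det (∑ k, ((X : ℝ[X]) ^ d k) • (S k).map C) with hP
  have hdet : P ≠ 0 := det_pencil_ne_zero_of_eval d S ha
  set T := P.roots.toFinset with hT
  have hTmem : ∀ x ∈ Set.Icc a b, (∑ k, x ^ d k • S k).det = 0 → x ∈ T :=
    fun x _ hx => mem_rootSet_of_det_eq_zero d S hdet hx
  have hroot : ∀ t ∈ T, (∑ k, t ^ d k • S k).det = 0 := fun t ht => DefiniteMoments.det_eval_eq_zero_of_mem d S ht
  -- multiplicity currency on the window
  have hsum : ∑ t ∈ T.filter (fun t => a < t ∧ t < b), (Fintype.card ι - (∑ k, t ^ d k • S k).rank)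
      = Multiset.card (P.roots.filter (fun t => a < t ∧ t < b)) :=
    sum_corank_eq_card_roots_filter d S hS _ fun t ht u hu hu0 => by
      obtain ⟨htT, h1, h2⟩ := Finset.mem_filter.1 ht
      exact (hneg t h1 h2 (hroot t htT) u hu hu0).ne
  constructor
  · have h := negIndex_telescope (fun x => ∑ k, x ^ d k • S k) (continuous_pencil_entry d S) (isHermitian_pencil d S hS)
      T (fun t => Fintype.card ι - (∑ k, t ^ d k • S k).rank) (fun _ => 0) hab hTmem ha hb
      (fun t ht h1 h2 => ((pencil_indices_eq_of_negType d S hS t (hneg t h1 h2 (hroot t ht))).1).mono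
        fun x hx => hx.1)
      (fun t ht h1 h2 => ((pencil_indices_eq_of_negType d S hS t (hneg t h1 h2 (hroot t ht))).2).mono
        fun x hx => by rw [add_zero]; exact hx.1)
    rw [Finset.sum_const_zero, add_zero, hsum] at h
    omega
  · have h := posIndex_telescope (fun x => ∑ k, x ^ d k • S k) (continuous_pencil_entry d S) (isHermitian_pencil d S hS)
      T (fun _ => 0) (fun t => Fintype.card ι - (∑ k, t ^ d k • S k).rank) hab hTmem ha hb
      (fun t ht h1 h2 => ((pencil_indices_eq_of_negType d S hS t (hneg t h1 h2 (hroot t ht))).1).mono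
        fun x hx => by rw [add_zero]; exact hx.2.1)
      (fun t ht h1 h2 => ((pencil_indices_eq_of_negType d S hS t (hneg t h1 h2 (hroot t ht))).2).mono
        fun x hx => hx.2.1)
    rw [Finset.sum_const_zero, add_zero, hsum] at h
    omega

/-- **THE ONE-TYPE WINDOW LAW (positive type)**: every root in `(a, b)` of POSITIVE type ⇒ the roots in `(a, b)` counted with
multiplicity number exactly `ν(F(a)) − ν(F(b)) = π(F(b)) − π(F(a))`. [folklore] -/
theorem card_roots_Ioo_add_negIndex_eq_of_posType (d : κ → ℕ) (S : κ → Matrix ι ι ℝ) (hS : ∀ k, (S k).IsSymm)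
    {a b : ℝ} (hab : a < b) (ha : (∑ k, a ^ d k • S k).det ≠ 0) (hb : (∑ k, b ^ d k • S k).det ≠ 0)
    (hpos : ∀ t, a < t → t < b → (∑ k, t ^ d k • S k).det = 0 → ∀ u : ι → ℝ, (∑ k, t ^ d k • S k) *ᵥ u = 0 → u ≠ 0 →
      0 < (derivative (∑ k, C (u ⬝ᵥ (S k *ᵥ u)) * (X : ℝ[X]) ^ d k)).eval t) :
    Multiset.card ((Matrix.det (∑ k, ((X : ℝ[X]) ^ d k) • (S k).map C)).roots.filter (fun t => a < t ∧ t < b))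
        + Fintype.card {j // (isHermitian_pencil d S hS b).eigenvalues j < 0}
      = Fintype.card {j // (isHermitian_pencil d S hS a).eigenvalues j < 0} ∧
    Multiset.card ((Matrix.det (∑ k, ((X : ℝ[X]) ^ d k) • (S k).map C)).roots.filter (fun t => a < t ∧ t < b))
        + Fintype.card {j // 0 < (isHermitian_pencil d S hS a).eigenvalues j}
      = Fintype.card {j // 0 < (isHermitian_pencil d S hS b).eigenvalues j} := by
  classical
  set P := Matrix.det (∑ k, ((X : ℝ[X]) ^ d k) • (S k).map C) with hP
  have hdet : P ≠ 0 := det_pencil_ne_zero_of_eval d S ha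
  set T := P.roots.toFinset with hT
  have hTmem : ∀ x ∈ Set.Icc a b, (∑ k, x ^ d k • S k).det = 0 → x ∈ T :=
    fun x _ hx => mem_rootSet_of_det_eq_zero d S hdet hx
  have hroot : ∀ t ∈ T, (∑ k, t ^ d k • S k).det = 0 := fun t ht => DefiniteMoments.det_eval_eq_zero_of_mem d S ht
  have hsum : ∑ t ∈ T.filter (fun t => a < t ∧ t < b), (Fintype.card ι - (∑ k, t ^ d k • S k).rank)
      = Multiset.card (P.roots.filter (fun t => a < t ∧ t < b)) :=
    sum_corank_eq_card_roots_filter d S hS _ fun t ht u hu hu0 => by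
      obtain ⟨htT, h1, h2⟩ := Finset.mem_filter.1 ht
      exact (hpos t h1 h2 (hroot t htT) u hu hu0).ne'
  constructor
  · have h := negIndex_telescope (fun x => ∑ k, x ^ d k • S k) (continuous_pencil_entry d S) (isHermitian_pencil d S hS)
      T (fun _ => 0) (fun t => Fintype.card ι - (∑ k, t ^ d k • S k).rank) hab hTmem ha hb
      (fun t ht h1 h2 => ((pencil_indices_eq_of_posType d S hS t (hpos t h1 h2 (hroot t ht))).1).mono
        fun x hx => by rw [add_zero]; exact hx.1)
      (fun t ht h1 h2 => ((pencil_indices_eq_of_posType d S hS t (hpos t h1 h2 (hroot t ht))).2).mono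
        fun x hx => hx.1)
    rw [Finset.sum_const_zero, add_zero, hsum] at h
    omega
  · have h := posIndex_telescope (fun x => ∑ k, x ^ d k • S k) (continuous_pencil_entry d S) (isHermitian_pencil d S hS)
      T (fun t => Fintype.card ι - (∑ k, t ^ d k • S k).rank) (fun _ => 0) hab hTmem ha hb
      (fun t ht h1 h2 => ((pencil_indices_eq_of_posType d S hS t (hpos t h1 h2 (hroot t ht))).1).mono
        fun x hx => hx.2.1)
      (fun t ht h1 h2 => ((pencil_indices_eq_of_posType d S hS t (hpos t h1 h2 (hroot t ht))).2).mono
        fun x hx => by rw [add_zero]; exact hx.2.1)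
    rw [Finset.sum_const_zero, add_zero, hsum] at h
    omega

/-! ## §3 The index formula on a window of definite-type roots -/

/-- **THE INDEX FORMULA.**  `F(X) = ∑ₖ X^{dₖ}Sₖ` real symmetric, `a < b` non-singular scales, every root of `det F` in `(a, b)` of
DEFINITE type.  With `N⁻` (resp. `N⁺`) the number of negative-type (resp. remaining, hence positive-type) roots in `(a, b)`
counted with multiplicity: `ν(F(b)) + N⁺ = ν(F(a)) + N⁻`, `π(F(b)) + N⁻ = π(F(a)) + N⁺`, and `N⁻ + N⁺` is the number of roots
in `(a, b)` with multiplicity.  Hence `#roots = |ν(F(b)) − ν(F(a))| + 2·min(N⁻, N⁺)`. [folklore] -/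
theorem index_formula (d : κ → ℕ) (S : κ → Matrix ι ι ℝ) (hS : ∀ k, (S k).IsSymm)
    {a b : ℝ} (hab : a < b) (ha : (∑ k, a ^ d k • S k).det ≠ 0) (hb : (∑ k, b ^ d k • S k).det ≠ 0)
    (htype : ∀ t, a < t → t < b → (∑ k, t ^ d k • S k).det = 0 →
      (∀ u : ι → ℝ, (∑ k, t ^ d k • S k) *ᵥ u = 0 → u ≠ 0 →
        (derivative (∑ k, C (u ⬝ᵥ (S k *ᵥ u)) * (X : ℝ[X]) ^ d k)).eval t < 0) ∨
      (∀ u : ι → ℝ, (∑ k, t ^ d k • S k) *ᵥ u = 0 → u ≠ 0 →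
        0 < (derivative (∑ k, C (u ⬝ᵥ (S k *ᵥ u)) * (X : ℝ[X]) ^ d k)).eval t))
    (negType : ℝ → Prop) [DecidablePred negType]
    (hnegType : ∀ t, a < t → t < b → (∑ k, t ^ d k • S k).det = 0 →
      (negType t ↔ ∀ u : ι → ℝ, (∑ k, t ^ d k • S k) *ᵥ u = 0 → u ≠ 0 →
        (derivative (∑ k, C (u ⬝ᵥ (S k *ᵥ u)) * (X : ℝ[X]) ^ d k)).eval t < 0)) :
    Fintype.card {j // (isHermitian_pencil d S hS b).eigenvalues j < 0}
        + Multiset.card ((Matrix.det (∑ k, ((X : ℝ[X]) ^ d k) • (S k).map C)).roots.filter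
            (fun t => (a < t ∧ t < b) ∧ ¬ negType t))
      = Fintype.card {j // (isHermitian_pencil d S hS a).eigenvalues j < 0}
        + Multiset.card ((Matrix.det (∑ k, ((X : ℝ[X]) ^ d k) • (S k).map C)).roots.filter
            (fun t => (a < t ∧ t < b) ∧ negType t)) ∧
    Fintype.card {j // 0 < (isHermitian_pencil d S hS b).eigenvalues j}
        + Multiset.card ((Matrix.det (∑ k, ((X : ℝ[X]) ^ d k) • (S k).map C)).roots.filter
            (fun t => (a < t ∧ t < b) ∧ negType t))
      = Fintype.card {j // 0 < (isHermitian_pencil d S hS a).eigenvalues j}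
        + Multiset.card ((Matrix.det (∑ k, ((X : ℝ[X]) ^ d k) • (S k).map C)).roots.filter
            (fun t => (a < t ∧ t < b) ∧ ¬ negType t)) ∧
    Multiset.card ((Matrix.det (∑ k, ((X : ℝ[X]) ^ d k) • (S k).map C)).roots.filter
            (fun t => (a < t ∧ t < b) ∧ negType t))
        + Multiset.card ((Matrix.det (∑ k, ((X : ℝ[X]) ^ d k) • (S k).map C)).roots.filter
            (fun t => (a < t ∧ t < b) ∧ ¬ negType t))
      = Multiset.card ((Matrix.det (∑ k, ((X : ℝ[X]) ^ d k) • (S k).map C)).roots.filter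
            (fun t => a < t ∧ t < b)) := by
  classical
  set P := Matrix.det (∑ k, ((X : ℝ[X]) ^ d k) • (S k).map C) with hP
  have hdet : P ≠ 0 := det_pencil_ne_zero_of_eval d S ha
  set T := P.roots.toFinset with hT
  have hTmem : ∀ x ∈ Set.Icc a b, (∑ k, x ^ d k • S k).det = 0 → x ∈ T :=
    fun x _ hx => mem_rootSet_of_det_eq_zero d S hdet hx
  have hroot : ∀ t ∈ T, (∑ k, t ^ d k • S k).det = 0 := fun t ht => DefiniteMoments.det_eval_eq_zero_of_mem d S ht
  -- jump data: negative type jumps `ν` up on the right, positive type on the left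
  set cr : ℝ → ℕ := fun t => Fintype.card ι - (∑ k, t ^ d k • S k).rank with hcr
  set jm : ℝ → ℕ := fun t => if negType t then cr t else 0 with hjm
  set jp : ℝ → ℕ := fun t => if negType t then 0 else cr t with hjp
  -- positive type at the non-negative-type roots
  have hposOf : ∀ t, a < t → t < b → (∑ k, t ^ d k • S k).det = 0 → ¬ negType t →
      ∀ u : ι → ℝ, (∑ k, t ^ d k • S k) *ᵥ u = 0 → u ≠ 0 →
        0 < (derivative (∑ k, C (u ⬝ᵥ (S k *ᵥ u)) * (X : ℝ[X]) ^ d k)).eval t := by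
    intro t h1 h2 hd hn
    rcases htype t h1 h2 hd with h | h
    · exact absurd ((hnegType t h1 h2 hd).2 h) hn
    · exact h
  -- the one-sided jump hypotheses of the telescope, for `ν`
  have hjr : ∀ t ∈ T, a < t → t < b → ∀ᶠ x in 𝓝[>] t,
      Fintype.card {j // (isHermitian_pencil d S hS x).eigenvalues j < 0}
        = Fintype.card {j // (isHermitian_pencil d S hS t).eigenvalues j < 0} + jm t := by
    intro t ht h1 h2
    by_cases hn : negType t
    · have hneg := (hnegType t h1 h2 (hroot t ht)).1 hn
      refine ((pencil_indices_eq_of_negType d S hS t hneg).1).mono fun x hx => ?_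
      rw [hjm]; simp only [hn, if_true]; exact hx.1
    · refine ((pencil_indices_eq_of_posType d S hS t (hposOf t h1 h2 (hroot t ht) hn)).1).mono fun x hx => ?_
      rw [hjm]; simp only [hn, if_false, add_zero]; exact hx.1
  have hjl : ∀ t ∈ T, a < t → t < b → ∀ᶠ x in 𝓝[<] t,
      Fintype.card {j // (isHermitian_pencil d S hS x).eigenvalues j < 0}
        = Fintype.card {j // (isHermitian_pencil d S hS t).eigenvalues j < 0} + jp t := by
    intro t ht h1 h2
    by_cases hn : negType t
    · have hneg := (hnegType t h1 h2 (hroot t ht)).1 hn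
      refine ((pencil_indices_eq_of_negType d S hS t hneg).2).mono fun x hx => ?_
      rw [hjp]; simp only [hn, if_true, add_zero]; exact hx.1
    · refine ((pencil_indices_eq_of_posType d S hS t (hposOf t h1 h2 (hroot t ht) hn)).2).mono fun x hx => ?_
      rw [hjp]; simp only [hn, if_false]; exact hx.1
  -- and for `π`
  have hjr' : ∀ t ∈ T, a < t → t < b → ∀ᶠ x in 𝓝[>] t,
      Fintype.card {j // 0 < (isHermitian_pencil d S hS x).eigenvalues j}
        = Fintype.card {j // 0 < (isHermitian_pencil d S hS t).eigenvalues j} + jp t := by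
    intro t ht h1 h2
    by_cases hn : negType t
    · have hneg := (hnegType t h1 h2 (hroot t ht)).1 hn
      refine ((pencil_indices_eq_of_negType d S hS t hneg).1).mono fun x hx => ?_
      rw [hjp]; simp only [hn, if_true, add_zero]; exact hx.2.1
    · refine ((pencil_indices_eq_of_posType d S hS t (hposOf t h1 h2 (hroot t ht) hn)).1).mono fun x hx => ?_
      rw [hjp]; simp only [hn, if_false]; exact hx.2.1
  have hjl' : ∀ t ∈ T, a < t → t < b → ∀ᶠ x in 𝓝[<] t,
      Fintype.card {j // 0 < (isHermitian_pencil d S hS x).eigenvalues j}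
        = Fintype.card {j // 0 < (isHermitian_pencil d S hS t).eigenvalues j} + jm t := by
    intro t ht h1 h2
    by_cases hn : negType t
    · have hneg := (hnegType t h1 h2 (hroot t ht)).1 hn
      refine ((pencil_indices_eq_of_negType d S hS t hneg).2).mono fun x hx => ?_
      rw [hjm]; simp only [hn, if_true]; exact hx.2.1
    · refine ((pencil_indices_eq_of_posType d S hS t (hposOf t h1 h2 (hroot t ht) hn)).2).mono fun x hx => ?_
      rw [hjm]; simp only [hn, if_false, add_zero]; exact hx.2.1
  have hν := negIndex_telescope (fun x => ∑ k, x ^ d k • S k) (continuous_pencil_entry d S) (isHermitian_pencil d S hS)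
    T jm jp hab hTmem ha hb hjr hjl
  have hπ := posIndex_telescope (fun x => ∑ k, x ^ d k • S k) (continuous_pencil_entry d S) (isHermitian_pencil d S hS)
    T jp jm hab hTmem ha hb hjr' hjl'
  -- the two sums are the typed multiplicity counts
  have hsm : ∑ t ∈ T.filter (fun t => a < t ∧ t < b), jm t
      = Multiset.card (P.roots.filter (fun t => (a < t ∧ t < b) ∧ negType t)) := by
    rw [hjm, Finset.sum_ite, Finset.sum_const_zero, add_zero, Finset.filter_filter]
    exact sum_corank_eq_card_roots_filter d S hS _ fun t ht u hu hu0 => by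
      obtain ⟨htT, ⟨h1, h2⟩, hn⟩ := Finset.mem_filter.1 ht
      exact ((hnegType t h1 h2 (hroot t htT)).1 hn u hu hu0).ne
  have hsp : ∑ t ∈ T.filter (fun t => a < t ∧ t < b), jp t
      = Multiset.card (P.roots.filter (fun t => (a < t ∧ t < b) ∧ ¬ negType t)) := by
    rw [hjp, Finset.sum_ite, Finset.sum_const_zero, zero_add, Finset.filter_filter]
    exact sum_corank_eq_card_roots_filter d S hS _ fun t ht u hu hu0 => by
      obtain ⟨htT, ⟨h1, h2⟩, hn⟩ := Finset.mem_filter.1 ht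
      exact (hposOf t h1 h2 (hroot t htT) hn u hu hu0).ne'
  rw [hsm, hsp] at hν hπ
  refine ⟨hν, hπ, ?_⟩
  have hsplit : Multiset.filter (fun t => (a < t ∧ t < b) ∧ negType t) P.roots
      + Multiset.filter (fun t => (a < t ∧ t < b) ∧ ¬ negType t) P.roots
      = Multiset.filter (fun t => a < t ∧ t < b) P.roots := by
    conv_rhs => rw [← Multiset.filter_add_not (p := negType) (Multiset.filter (fun t => a < t ∧ t < b) P.roots)]
    rw [Multiset.filter_filter, Multiset.filter_filter]
    congr 1 <;> exact Multiset.filter_congr (fun t _ => by tauto)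
  rw [← Multiset.card_add, hsplit]

end Pencil

end Inertia

end Summit.ValiantsHypothesis.ValiantsHypothesis.Theorems.LacunarySymmetroidMatrixDescartes
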